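import Literature.NumberTheory.Automorphic.UnitaryGroupHeisenbergConjThreeFactorHead
import Literature.NumberTheory.Automorphic.QuasiSplitTestLiftLipschitz
import Literature.NumberTheory.Automorphic.LocalTestFunctionTestClass
import HarnessLib

/-!
# The oscillation estimate for Arthur's truncated kernel on `U(3)`, closed form: for a test
# function `f`, `‖f x − f (x · (bk)⁻¹ u (bk))‖ ≤ C_f · ρ(d)` on the conjugated Heisenberg domain

Topic `NumberTheory/Automorphic`; namespace `Literature.NumberTheory.Automorphic.UnitaryGroup`.
Proof file: theorems only (no definition, no named fact, no instance, no `sorry`); imports = tree.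

THE POINT (Rogawski (1990), §2.2 p. 13; Gelbart (1975), (9.44)–(9.46)). This is the FOLD of the
oscillation row of the road to ★ `UnitaryGroup.TruncatedKernelIntegrable`: the three-factor normal
form of the conjugated Heisenberg element with its archimedean contraction bound and finite-level
membership (★ `exists_isCompact_forall_threeFactor`, `UnitaryGroupHeisenbergConjThreeFactorHead`,
over ★ `UnipotentThreeDirections`) is fed into the test-function side (★
`IsQuasiSplitTest.exists_level_forall_norm_sub_conj_le`, `QuasiSplitTestLiftLipschitz`, over ★
`RightModulusOneParameterProducts` and ★ `UnitaryGroupTruncatedKernelOscillation`); the admissible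
level `U` of `f` is matched with the principal congruence subgroup `K(𝔫)` of the normal form by ★
`exists_principalCongruenceLevel_le_of_mem_finiteLevelsGL`. RESULT: for `f ∈ C_c^∞(U(J₃)(𝔸_F))` and
compact sets `KN, Ω ⊆ N(𝔸_F)` there are an ideal `𝔫 ≠ 0` and `C_f ≥ 0` such that for every
`b ∈ B(𝔸_F)` with unipotent part in `Ω`, every `k` in the standard maximal compact subgroup, and
every `u ∈ KN` whose conjugate `b⁻¹ u b` has entries of level `𝔫`,
`‖f x − f (x · (bk)⁻¹ u (bk))‖ ≤ C_f · ρ(d)`, `ρ(d) = max (‖(d₀⁻¹d₁)_∞‖, ‖(d₀⁻¹d₂)_∞‖, ‖(d₁⁻¹d₂)_∞‖)`,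
`d = diagUnit b` — the hypothesis `hρ` of the Siegel-set kernel estimate (★
`exists_forall_enorm_kernel_sub_kernelBorel_le_of_oscillation`, `UnitaryGroupKernelDifferenceSiegelEstimate`)
with `ρ(b) := C_f · ρ(diagUnit b)`. The only input left to the assembly is the divisibility of the
fundamental domain `𝓕_m` (★ `mem_torusConj_image_iff`, `UnitaryGroupHeisenbergConjFundamentalDomain`).

* `IsQuasiSplitTest.exists_forall_norm_sub_borel_conj_le` — the closed oscillation estimate.

## References

* J. D. Rogawski, *Automorphic Representations of Unitary Groups in Three Variables*, Ann. of
  Math. Studies 123 (1990), §2.2 (p. 13) [Rogawski1990].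
* S. Gelbart, *Automorphic forms on adele groups*, Ann. of Math. Studies 83 (1975), §9.B
  (9.44)–(9.46) [Gelbart1975].
-/

set_option autoImplicit false

noncomputable section

-- `open scoped Classical` is needed to see the Mathlib (normed ring) instances on `mixedSpace E` (note H5 of
-- `AdelicGLnGlue`)
open scoped MatrixGroups Matrix Classical Topology
open NumberField NumberField.mixedEmbedding IsDedekindDomain Set

namespace Literature.NumberTheory.Automorphic

namespace UnitaryGroup

variable {F E : Type} [Field F] [NumberField F] [Field E] [NumberField E] [Algebra F E]
  {c : E ≃ₐ[F] E}

/-- **THE OSCILLATION ESTIMATE FOR THE TRUNCATED KERNEL ON `U(3)`, CLOSED FORM.** For a test function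
`f ∈ C_c^∞(U(J₃)(𝔸_F))` and compact `KN, Ω ⊆ N(𝔸_F)` there are `𝔫 ≠ 0` and `C_f ≥ 0` with: for all
`b ∈ B(𝔸_F)` whose unipotent part `(torusPart b)⁻¹ b` lies in `Ω`, all `k` with
`adelicVal k ∈ standardMaximalCompactGL 3 E`, if every `u ∈ KN` has `b⁻¹ u b` with off-diagonal
entries (and their conjugates) of valuation `≤ idealRadius E v 𝔫` at every finite `v`, then
`‖f x − f (x · (bk)⁻¹ u (bk))‖ ≤ C_f · max (‖(d₀⁻¹d₁)_∞‖, ‖(d₀⁻¹d₂)_∞‖, ‖(d₁⁻¹d₂)_∞‖)` for all `x` and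
all `u ∈ KN`, `d = diagUnit b`. [cite: Rogawski1990, §2.2 (p. 13)] -/
theorem IsQuasiSplitTest.exists_forall_norm_sub_borel_conj_le (hc : c * c = 1)
    {f : (quasiSplit F E c 3).Adelic → ℂ} (hf : IsQuasiSplitTest F E c 3 f)
    {KN Ω : Set (adelicUnipotent F E c 3)} (hKN : IsCompact KN) (hΩ : IsCompact Ω) :
    ∃ 𝔫 : Ideal (𝓞 E), 𝔫 ≠ 0 ∧ ∃ C : ℝ, 0 ≤ C ∧
      ∀ (b : borelAdelic F E c 3) (k : (quasiSplit F E c 3).Adelic),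
        adelicVal F E c 3 _ k ∈ standardMaximalCompactGL 3 E →
        (⟨(((torusPart b)⁻¹ * b : borelAdelic F E c 3) : (quasiSplit F E c 3).Adelic),
            torusPart_inv_mul_mem_adelicUnipotent b⟩ : adelicUnipotent F E c 3) ∈ Ω →
        (∀ u ∈ KN, ∀ i j : Fin 3, i ≠ j → ∀ v : HeightOneSpectrum (𝓞 E),
          Valued.v ((((adelicVal F E c 3 _ ((b : (quasiSplit F E c 3).Adelic)⁻¹ *
              (u : (quasiSplit F E c 3).Adelic) * (b : (quasiSplit F E c 3).Adelic)) :
              GL (Fin 3) (AdeleRing (𝓞 E) E)) : Matrix (Fin 3) (Fin 3) (AdeleRing (𝓞 E) E)) i j).2 v) ≤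
            idealRadius E v 𝔫 ∧
          Valued.v ((conjAdele F E c (((adelicVal F E c 3 _ ((b : (quasiSplit F E c 3).Adelic)⁻¹ *
              (u : (quasiSplit F E c 3).Adelic) * (b : (quasiSplit F E c 3).Adelic)) :
              GL (Fin 3) (AdeleRing (𝓞 E) E)) : Matrix (Fin 3) (Fin 3) (AdeleRing (𝓞 E) E)) i j)).2 v) ≤
            idealRadius E v 𝔫) →
        ∀ x : (quasiSplit F E c 3).Adelic, ∀ u ∈ KN,
          ‖f x - f (x * (((b : (quasiSplit F E c 3).Adelic) * k)⁻¹ * (u : (quasiSplit F E c 3).Adelic) *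
              ((b : (quasiSplit F E c 3).Adelic) * k)))‖ ≤
            C * max (max
              ‖archHom E ((((diagUnit b.2 0)⁻¹ * diagUnit b.2 1 : (AdeleRing (𝓞 E) E)ˣ)) : AdeleRing (𝓞 E) E)‖
              ‖archHom E ((((diagUnit b.2 0)⁻¹ * diagUnit b.2 2 : (AdeleRing (𝓞 E) E)ˣ)) : AdeleRing (𝓞 E) E)‖)
              ‖archHom E ((((diagUnit b.2 1)⁻¹ * diagUnit b.2 2 : (AdeleRing (𝓞 E) E)ˣ)) : AdeleRing (𝓞 E) E)‖ := by
  -- the geometry: compact direction set `S`, constant `C` and the three-factor normal form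
  obtain ⟨S, hS, C, hC0, hgeom⟩ := exists_isCompact_forall_threeFactor (F := F) (E := E) (c := c) hc hKN hΩ
  -- the test function: level `U` and Lipschitz constant `L` for the directions in `S`
  obtain ⟨U, hU, L, hL0, hL⟩ := hf.exists_level_forall_norm_sub_conj_le hS
  -- a principal congruence subgroup inside the level
  obtain ⟨𝔫, h𝔫, hle, -⟩ :=
    exists_principalCongruenceLevel_le_of_mem_finiteLevelsGL (n := 3) (K := E) hU Filter.univ_mem
  refine ⟨𝔫, h𝔫, 3 * L * C, by positivity, fun b k hk hn₀ hval x u hu => ?_⟩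
  have h := hL ((b : (quasiSplit F E c 3).Adelic) * k)
    (C * max (max
      ‖archHom E ((((diagUnit b.2 0)⁻¹ * diagUnit b.2 1 : (AdeleRing (𝓞 E) E)ˣ)) : AdeleRing (𝓞 E) E)‖
      ‖archHom E ((((diagUnit b.2 0)⁻¹ * diagUnit b.2 2 : (AdeleRing (𝓞 E) E)ˣ)) : AdeleRing (𝓞 E) E)‖)
      ‖archHom E ((((diagUnit b.2 1)⁻¹ * diagUnit b.2 2 : (AdeleRing (𝓞 E) E)ˣ)) : AdeleRing (𝓞 E) E)‖)
    KN (fun u' hu' => ?_) x u hu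
  · calc _ ≤ 3 * L * (C * _) := h
      _ = 3 * L * C * _ := by ring
  · obtain ⟨t₁, t₂, t₃, X₁, X₂, X₃, w, hX₁, hX₂, hX₃, hw, ht₁, ht₂, ht₃, e⟩ :=
      hgeom b k hk hn₀ 𝔫 u' hu' (hval u' hu')
    exact ⟨t₁, t₂, t₃, X₁, X₂, X₃, w, hX₁, hX₂, hX₃, hle hw, ht₁, ht₂, ht₃, e⟩

end UnitaryGroup

end Literature.NumberTheory.Automorphic

end
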